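/-
COR-CM (cell pub-hodgecm2) — ¬hJ RUSH, HEAD-B (EDITION B) R1 supply, leaf 4a∕5 (split off #4 per nothj-plan l.20708): the ONE heavy
declaration `exists_representatives_isColimit_componentInj` in a file of its own, with the final change of legs done through an ABSTRACT
lemma (`nonempty_isColimit_cofan_of_legs_eq`) so that neither the elaborator nor the kernel ever tests `rfl` against the concrete
isomorphism `theta` (the tree twin ✔ `exists_isColimit_componentInj` does, at `maxHeartbeats 4000000` and ≈ 150 s; this cut needs
default heartbeats).
Author d2bridge-prove-5 (`AlbStarQValue.section`), binders made explicit and the tree twin's proof ending by mukey-p9 (prover-pub-hodgecm2-mukey-p9-g6-0).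
THEOREMS ONLY (kernel lane); no `def`, no `variable`, no notation.  FRAMING: HC_CM is NOT proved; nothing here asserts hJ, hJ₀, (P-K), R1 or negations.
-/
import Summits.HodgeConjecture.CorCM.D2Bridge.ComponentAlbanesePinLaw
import HarnessLib

set_option autoImplicit false

/-!
# The components at double-coset representatives form a coproduct cofan of `X_K ⊗_{ῑ₁} ℂ` (representatives KEPT)

✔ `exists_isColimit_componentInj` (LAW (v) of the pin, `ShimuraComponentInj.lean`) proves that the pieces `P_{Γ_K.conj (g q)}` at the
record's representatives `g` form a colimit cofan of `X_K ⊗ ℂ` but DISCARDS the representatives' property `⟦(g q) K⟧ = q`; the R1 reduction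
(`NotHJAlbStarBijectiveOfLemma24.lean`: `levelQ Γ_K ≃ Π_q H¹(P_{g q})` by evaluation AT REPRESENTATIVES) needs it kept.  Same proof, token
for token, with the conjunction exported. [Deligne1979ShimuraVarieties] §2.1.2; [Mumford1981] §4B (4.15); [Liu2021] §4.2.
-/

noncomputable section

namespace Summit.HodgeConjecture.CorCM.D2Bridge.LevelQReps

open Function CategoryTheory CategoryTheory.Limits AlgebraicGeometry NumberField
open Literature.AlgebraicGeometry.Motives Literature.AlgebraicGeometry.HodgeTheory Literature.AlgebraicGeometry.ShimuraVarieties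
open Literature.AlgebraicGeometry.ShimuraVarieties.UnitaryCanonicalModel
open Literature.NumberTheory.Automorphic Literature.NumberTheory.Automorphic.UnitaryGroup Literature.NumberTheory.Automorphic.PicardCM
open Literature.NumberTheory.Automorphic.Liu2021 Literature.NumberTheory.Automorphic.Liu2021.AppendixC
open Literature.NumberTheory.Transcendental (Arapura2012_Cor_15_4_6)
open Summit.HodgeConjecture.CorCM.Model Summit.HodgeConjecture.CorCM.HComp
open HodgeCM.Model HodgeCM.Model.LevelTranslate HodgeCM.Model.TowerLevel
open Summit.HodgeConjecture.CorCM.D2Bridge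
open AbelianVariety (bcFunctor)
open Literature.NumberTheory.Automorphic.ShimuraDissection (CosetSpace)

/-- **Change of legs of a colimit cofan through isomorphisms, ABSTRACTLY** (so that the kernel never unfolds a concrete isomorphism such
as `theta`): if `(X, ι)` is a colimit cofan, `θ : X' ≅ X`, `e q : Y q ≅ P q`, and the candidate legs are `f q = (e q)⁻¹ ≫ ι q ≫ θ⁻¹`, then
`(X', f)` is a colimit cofan (✔ `nonempty_isColimit_cofan_of_iso` after transporting the point along `θ`). [folklore] -/
theorem nonempty_isColimit_cofan_of_legs_eq {C : Type*} [Category C] {Ξ : Type} {X X' : C} {Y P : Ξ → C}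
    (ι : ∀ q, Y q ⟶ X) (hcol : IsColimit (Cofan.mk X ι)) (θ : X' ≅ X) (e : ∀ q, Y q ≅ P q)
    (f : ∀ q, P q ⟶ X') (hf : ∀ q, f q = (e q).inv ≫ ι q ≫ θ.inv) : Nonempty (IsColimit (Cofan.mk X' f)) := by
  obtain rfl : f = fun q => (e q).symm.hom ≫ (ι q ≫ θ.inv) := funext fun q => by rw [hf q, Iso.symm_hom]
  exact nonempty_isColimit_cofan_of_iso (fun q => ι q ≫ θ.inv)
    (hcol.ofIsoColimit (Cofan.ext θ.symm (fun _ => rfl))) (fun q => (e q).symm)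

/-- **The components at DOUBLE-COSET REPRESENTATIVES form a coproduct cofan of `X_K ⊗_{ῑ₁} ℂ`** — ✔ `exists_isColimit_componentInj` with the
representatives' property `⟦(g q) K⟧ = q` KEPT (the tree lemma discards it): index set `Ξ_K = U(V)(L₀)\U(V)(𝔸_f)/K`.  Same proof
(d2bridge-prove-5), the last step through the abstract `nonempty_isColimit_cofan_of_legs_eq` (no `rfl` against `theta`).
[cite: Deligne1979ShimuraVarieties, §2.1.2] [cite: Mumford1981, §4B (4.15) Corollary, p. 67] -/
theorem exists_representatives_isColimit_componentInj {L : HodgeCM.CMField} {ι₁ : L →+* ℂ} (V : HodgeCM.HermSpace3 L ι₁)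
    (hU : BallQuotientUniformisedDatum) (h₃ : CMAbelianVarietyRealised) (h4 : 4 ≤ Module.finrank ℚ L)
    (h : exists_recordSystem) (hHD : exists_isReal_hodgeModel) [Algebra L ℂ] (hι : (algebraMap L ℂ).comp (cmConjRingHom L) = ι₁)
    (K : C5.SmallLevel (K3 (pkgV V))) :
    ∃ g : MulAction.orbitRel.Quotient ↥(Urat V) (CosetSpace (ρ V) (levelOf V K).K) → V.adelicFin,
      (∀ q, (Quotient.mk'' (ShimuraDissection.CosetSpace.pt (ρ V) (levelOf V K).K (g q)) :
        MulAction.orbitRel.Quotient ↥(Urat V) (CosetSpace (ρ V) (levelOf V K).K)) = q) ∧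
      Nonempty (IsColimit (Cofan.mk ((bcFunctor L ℂ).obj (XK V h K)) (fun q => componentInj V hU h₃ h4 h hHD hι K (g q)))) := by
  classical
  obtain ⟨g, hg, X, ι, hcol, B, hB⟩ := (recordOf h (pkgV V) h4).pieces K
  refine ⟨g, hg, ?_⟩
  -- each record piece IS the tree surface of its index, over the uniformisations
  have hiso : ∀ q, ∃ e : X q ≅ P V hU h₃ K (g q),
      ∀ v ∈ (B q).cone, AlgPoints.map e.hom ((B q).unif v) = (D V hU h₃ h4 K (g q)).unif v := by
    intro q
    obtain ⟨hH1, hΓ1, -⟩ := hB q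
    have hH2 : (B q).Hℂ = (D V hU h₃ h4 K (g q)).Hℂ := by rw [hH1, D_Hℂ]
    have hΓ2 : (B q).Γ.map (Matrix.GeneralLinearGroup.map (B q).τ₁) =
        (D V hU h₃ h4 K (g q)).Γ.map (Matrix.GeneralLinearGroup.map (D V hU h₃ h4 K (g q)).τ₁) := by rw [hΓ1, D_map_Γ]
    obtain ⟨e, he, -⟩ := UnitaryBallModelUnique.exists_iso_of_eq_of_nonempty
      (X₁ := X q) (X₂ := P V hU h₃ K (g q)) (D₁ := B q) (D₂ := D V hU h₃ h4 K (g q))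
      (let ⟨A, _⟩ := exists_isReal_hodgeModel_holds 2 (X q) (B q).isSmoothProjective; ⟨A⟩)
      ⟨BettiUniverse.realHodgeModel hHD (isSmoothProjective_P V hU h₃ K (g q))⟩ hH2 hΓ2
    exact ⟨e, he⟩
  choose e he using hiso
  exact nonempty_isColimit_cofan_of_legs_eq ι hcol (theta V h4 h hι K) e
    (fun q => componentInj V hU h₃ h4 h hHD hι K (g q))
    (fun q => componentInj_eq_of_piece V hU h₃ h4 h hHD hι K (g q) (B q) (hB q).1 (ι q) (hB q).2.2 (e q) (he q))

end Summit.HodgeConjecture.CorCM.D2Bridge.LevelQReps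

end
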